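import Summits.BirchSwinnertonDyer.Rank1Residual.AdditivePotMult.QuadraticBaseChangeTamagawaTypeIVInert
import HarnessLib

/-!
# `c_w(W_K) = 3 ↔ c_v(W) = 3` at an UNRAMIFIED place of ODD residue degree over a type-`IV` place

Row **T-MIL-B, B-3 companion** (n1011-p08 GEN 3): the odd-residue-degree twin of
`TypeIVTwist.localTamagawaNumber_baseChange_eq_three_of_kodairaSymbolAt_eq_IV_of_unramified_of_even`
(`QuadraticBaseChangeTamagawaTypeIVInert`): for `W/ℚ` elliptic, `v ∤ 3` of Kodaira type `IV`, any
number field `K` and `w ∣ v` with `e(w|v) = 1` and `f(w|v)` odd, `c_w(W_K) = 3 ↔ c_v(W) = 3` — the Step-5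
quadratic acquires no new root in an odd-degree residue extension. HONEST FRAMING: TOOL theorem; nothing
booked; no mark moved; no new definition, no named fact.
-/

noncomputable section

open scoped Classical NumberField
open WeierstrassCurve NumberField IsDedekindDomain IsLocalRing Polynomial Rat.HeightOneSpectrum
  Literature.NumberTheory.DiophantineGeometry.TateAlgorithm
  Literature.NumberTheory.EllipticCurves Literature.NumberTheory.EllipticCurves.LocalIndex
  Summit.BirchSwinnertonDyer.Rank1Residual.Additive

namespace Summit.BirchSwinnertonDyer.Rank1Residual.AdditivePotMult

namespace TypeIVTwist

variable {K : Type} [Field K] [NumberField K] (v : HeightOneSpectrum (𝓞 ℚ))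
  (W : WeierstrassCurve ℚ) [W.IsElliptic]

/-- **`c_w(W_K) = 3 ↔ c_v(W) = 3` at an unramified place `w ∣ v` of ODD residue degree over a place `v ∤ 3`
of `ℚ` of Kodaira type `IV`** (e.g. a split place, or any unramified place of an odd-degree field): the
Step-5 quadratic has a root in an odd-degree extension of `𝔽_ℓ` iff it has one in `𝔽_ℓ` (B-2c
`localTamagawaNumber_baseChange_eq_three_iff_of_odd_finrank_of_normalForm_IV`); same local plumbing
as the even case (local base-change map, uniformiser transport, minimality upstairs by `v(Δ) < 12`).
[cite: SilvermanATAEC1994, IV.9.4 Step 5 (PDF p. 344)] [cite: SilvermanAEC2009, Prop. VII.5.4 (a)] -/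
theorem localTamagawaNumber_baseChange_eq_three_iff_of_kodairaSymbolAt_eq_IV_of_unramified_of_odd
    (hv3 : (primesEquiv v : ℕ) ≠ 3) (hIV : W.kodairaSymbolAt v = .IV) {w : HeightOneSpectrum (𝓞 K)}
    (hw : w.under (𝓞 ℚ) = v) (he : w.asIdeal.ramificationIdx (𝓞 ℚ) = 1)
    (hf : Odd (w.asIdeal.inertiaDeg (𝓞 ℚ))) :
    ((W.baseChange K).baseChange (w.adicCompletion K)).localTamagawaNumber
        (w.adicCompletionIntegers K) = 3 ↔
      (W.baseChange (v.adicCompletion ℚ)).localTamagawaNumber (v.adicCompletionIntegers ℚ) = 3 := by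
  haveI hlies : w.asIdeal.LiesOver v.asIdeal := ⟨by rw [← hw]; rfl⟩
  haveI : Finite (ResidueField (v.adicCompletionIntegers ℚ)) :=
    finite_residueField_adicCompletionIntegers_rat v
  haveI : PerfectField (ResidueField (v.adicCompletionIntegers ℚ)) := PerfectField.ofFinite
  haveI : (W.baseChange (v.adicCompletion ℚ)).IsElliptic := by rw [baseChange]; infer_instance
  -- the local base-change map and its restriction to the valuation rings
  set ι : v.adicCompletion ℚ →+* w.adicCompletion K :=
    Literature.NumberTheory.Automorphic.adicCompletionOfLiesOver ℚ K v w with hιdef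
  have hιv : ∀ y, Valued.v (ι y) = Valued.v y := fun y ↦ by
    rw [hιdef, Literature.NumberTheory.Automorphic.valued_adicCompletionOfLiesOver,
      ramificationIdx'_eq_of_under_eq hw, he, pow_one]
  have hint : ∀ y ∈ v.adicCompletionIntegers ℚ, ι y ∈ w.adicCompletionIntegers K := fun y hy ↦
    Literature.NumberTheory.Automorphic.adicCompletionOfLiesOver_mem_adicCompletionIntegers ℚ K v w hy
  set ψ : v.adicCompletionIntegers ℚ →+* w.adicCompletionIntegers K :=
    ι.restrict (v.adicCompletionIntegers ℚ) (w.adicCompletionIntegers K) hint with hψdef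
  have hψ : ∀ y : v.adicCompletionIntegers ℚ,
      ((ψ y : w.adicCompletionIntegers K) : w.adicCompletion K) = ι (y : v.adicCompletion ℚ) :=
    fun _ ↦ rfl
  letI algR : Algebra (v.adicCompletionIntegers ℚ) (w.adicCompletionIntegers K) := ψ.toAlgebra
  letI algF : Algebra (v.adicCompletion ℚ) (w.adicCompletion K) := ι.toAlgebra
  letI algRL : Algebra (v.adicCompletionIntegers ℚ) (w.adicCompletion K) :=
    ((algebraMap (w.adicCompletionIntegers K) (w.adicCompletion K)).comp ψ).toAlgebra
  haveI : IsScalarTower (v.adicCompletionIntegers ℚ) (w.adicCompletionIntegers K)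
      (w.adicCompletion K) := IsScalarTower.of_algebraMap_eq (fun _ ↦ rfl)
  haveI : IsScalarTower (v.adicCompletionIntegers ℚ) (v.adicCompletion ℚ) (w.adicCompletion K) :=
    IsScalarTower.of_algebraMap_eq (fun _ ↦ rfl)
  have halg : ∀ y : v.adicCompletionIntegers ℚ,
      algebraMap (v.adicCompletionIntegers ℚ) (w.adicCompletionIntegers K) y = ψ y := fun _ ↦ rfl
  haveI : IsLocalHom (algebraMap (v.adicCompletionIntegers ℚ) (w.adicCompletionIntegers K)) := by
    refine ⟨fun y hy ↦ ?_⟩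
    rw [HeightOneSpectrum.adicCompletionIntegers.isUnit_iff_valued_eq_one] at hy ⊢
    rwa [halg, hψ, hιv] at hy
  -- the minimal type-`IV` normal form at `v`
  obtain ⟨J, D, γ, ε, hJ, hmin, h1, h2, hγ, h4, hε, hdisc⟩ :=
    exists_normalForm_IV_of_kodairaSymbolAt_eq_IV v W hIV
  haveI := hmin
  have hϖ : Irreducible (algebraMap (v.adicCompletionIntegers ℚ) (w.adicCompletionIntegers K)
      (uniformizer (v.adicCompletionIntegers ℚ))) := by
    rw [irreducible_iff_valued_eq_exp_neg_one, halg, hψ, hιv]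
    exact valued_eq_exp_neg_one_of_irreducible v irreducible_uniformizer
  have h3 := isUnit_three_adicCompletionIntegers v hv3
  -- minimality upstairs: `v_w(Δ) = exp (-4) > exp (-12)`
  haveI : ((J.map (algebraMap (v.adicCompletionIntegers ℚ) (w.adicCompletionIntegers K))).baseChange
      (w.adicCompletion K)).IsMinimal (w.adicCompletionIntegers K) := by
    haveI : ((J.map (algebraMap (v.adicCompletionIntegers ℚ) (w.adicCompletionIntegers K))).baseChange
        (w.adicCompletion K)).IsIntegral (w.adicCompletionIntegers K) := ⟨⟨_, rfl⟩⟩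
    apply isMinimal_of_exp_neg_twelve_lt_valued_Δ_place
    have hΔ : ((J.map (algebraMap (v.adicCompletionIntegers ℚ) (w.adicCompletionIntegers K))).baseChange
        (w.adicCompletion K)).Δ = ι ((J.Δ : v.adicCompletionIntegers ℚ) : v.adicCompletion ℚ) := by
      rw [baseChange, map_Δ, map_Δ, halg, ← hψ]; rfl
    rw [hΔ, hιv]
    exact exp_neg_twelve_lt_valued_Δ_of_normalForm_IV v J h1 h2 irreducible_uniformizer hγ h4 hε
      hdisc h3
  -- `W_K ⊗ K_w = (W ⊗ ℚ_v) ⊗_ι K_w` (ring maps out of `ℚ` agree)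
  have hcurve : (W.baseChange K).baseChange (w.adicCompletion K) =
      (W.baseChange (v.adicCompletion ℚ)).baseChange (w.adicCompletion K) := by
    simp only [baseChange, WeierstrassCurve.map_map]
    rw [Subsingleton.elim ((algebraMap K (w.adicCompletion K)).comp (algebraMap ℚ K))
      ((algebraMap (v.adicCompletion ℚ) (w.adicCompletion K)).comp (algebraMap ℚ (v.adicCompletion ℚ)))]
  rw [hcurve]
  have hodd : Odd (Module.finrank (ResidueField (v.adicCompletionIntegers ℚ))
      (ResidueField (w.adicCompletionIntegers K))) := by
    rw [finrank_residueField_eq_inertiaDeg v hw]; exact hf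
  exact localTamagawaNumber_baseChange_eq_three_iff_of_odd_finrank_of_normalForm_IV
    (W.baseChange (v.adicCompletion ℚ)) J D hJ h1 h2 irreducible_uniformizer hϖ hγ h4 hε hdisc hodd


/-- **`c_w(W_K) = 3 ↔ c_v(W) = 3` at an unramified place of ODD residue degree over a place `v ∤ 3` of
Kodaira type `IV*`** — the Step-8 twin (B-2c `localTamagawaNumber_baseChange_eq_three_iff_of_normalForm_IVstar`
upstairs, B-1 `localTamagawaNumber_eq_three_iff_exists_root_of_normalForm_IVstar` downstairs, n1011-p01
`splits_map_iff_of_natDegree_eq_two_of_odd_finrank`).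
[cite: SilvermanATAEC1994, IV.9.4 Step 8 (PDF p. 346)] [cite: SilvermanAEC2009, Prop. VII.5.4 (a)] -/
theorem localTamagawaNumber_baseChange_eq_three_iff_of_kodairaSymbolAt_eq_IVstar_of_unramified_of_odd
    (hv3 : (primesEquiv v : ℕ) ≠ 3) (hIV : W.kodairaSymbolAt v = .IVstar) {w : HeightOneSpectrum (𝓞 K)}
    (hw : w.under (𝓞 ℚ) = v) (he : w.asIdeal.ramificationIdx (𝓞 ℚ) = 1)
    (hf : Odd (w.asIdeal.inertiaDeg (𝓞 ℚ))) :
    ((W.baseChange K).baseChange (w.adicCompletion K)).localTamagawaNumber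
        (w.adicCompletionIntegers K) = 3 ↔
      (W.baseChange (v.adicCompletion ℚ)).localTamagawaNumber (v.adicCompletionIntegers ℚ) = 3 := by
  haveI hlies : w.asIdeal.LiesOver v.asIdeal := ⟨by rw [← hw]; rfl⟩
  haveI : Finite (ResidueField (v.adicCompletionIntegers ℚ)) :=
    finite_residueField_adicCompletionIntegers_rat v
  haveI : PerfectField (ResidueField (v.adicCompletionIntegers ℚ)) := PerfectField.ofFinite
  haveI : (W.baseChange (v.adicCompletion ℚ)).IsElliptic := by rw [baseChange]; infer_instance
  set ι : v.adicCompletion ℚ →+* w.adicCompletion K :=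
    Literature.NumberTheory.Automorphic.adicCompletionOfLiesOver ℚ K v w with hιdef
  have hιv : ∀ y, Valued.v (ι y) = Valued.v y := fun y ↦ by
    rw [hιdef, Literature.NumberTheory.Automorphic.valued_adicCompletionOfLiesOver,
      ramificationIdx'_eq_of_under_eq hw, he, pow_one]
  have hint : ∀ y ∈ v.adicCompletionIntegers ℚ, ι y ∈ w.adicCompletionIntegers K := fun y hy ↦
    Literature.NumberTheory.Automorphic.adicCompletionOfLiesOver_mem_adicCompletionIntegers ℚ K v w hy
  set ψ : v.adicCompletionIntegers ℚ →+* w.adicCompletionIntegers K :=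
    ι.restrict (v.adicCompletionIntegers ℚ) (w.adicCompletionIntegers K) hint with hψdef
  have hψ : ∀ y : v.adicCompletionIntegers ℚ,
      ((ψ y : w.adicCompletionIntegers K) : w.adicCompletion K) = ι (y : v.adicCompletion ℚ) :=
    fun _ ↦ rfl
  letI algR : Algebra (v.adicCompletionIntegers ℚ) (w.adicCompletionIntegers K) := ψ.toAlgebra
  letI algF : Algebra (v.adicCompletion ℚ) (w.adicCompletion K) := ι.toAlgebra
  letI algRL : Algebra (v.adicCompletionIntegers ℚ) (w.adicCompletion K) :=
    ((algebraMap (w.adicCompletionIntegers K) (w.adicCompletion K)).comp ψ).toAlgebra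
  haveI : IsScalarTower (v.adicCompletionIntegers ℚ) (w.adicCompletionIntegers K)
      (w.adicCompletion K) := IsScalarTower.of_algebraMap_eq (fun _ ↦ rfl)
  haveI : IsScalarTower (v.adicCompletionIntegers ℚ) (v.adicCompletion ℚ) (w.adicCompletion K) :=
    IsScalarTower.of_algebraMap_eq (fun _ ↦ rfl)
  have halg : ∀ y : v.adicCompletionIntegers ℚ,
      algebraMap (v.adicCompletionIntegers ℚ) (w.adicCompletionIntegers K) y = ψ y := fun _ ↦ rfl
  haveI : IsLocalHom (algebraMap (v.adicCompletionIntegers ℚ) (w.adicCompletionIntegers K)) := by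
    refine ⟨fun y hy ↦ ?_⟩
    rw [HeightOneSpectrum.adicCompletionIntegers.isUnit_iff_valued_eq_one] at hy ⊢
    rwa [halg, hψ, hιv] at hy
  obtain ⟨J, D, γ, ε, hJ, hmin, h1, h2, hγ, h4, hε, hdisc⟩ :=
    exists_normalForm_IVstar_of_kodairaSymbolAt_eq_IVstar v W hIV
  haveI := hmin
  have hϖ : Irreducible (algebraMap (v.adicCompletionIntegers ℚ) (w.adicCompletionIntegers K)
      (uniformizer (v.adicCompletionIntegers ℚ))) := by
    rw [irreducible_iff_valued_eq_exp_neg_one, halg, hψ, hιv]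
    exact valued_eq_exp_neg_one_of_irreducible v irreducible_uniformizer
  have h3 := isUnit_three_adicCompletionIntegers v hv3
  haveI : ((J.map (algebraMap (v.adicCompletionIntegers ℚ) (w.adicCompletionIntegers K))).baseChange
      (w.adicCompletion K)).IsMinimal (w.adicCompletionIntegers K) := by
    haveI : ((J.map (algebraMap (v.adicCompletionIntegers ℚ) (w.adicCompletionIntegers K))).baseChange
        (w.adicCompletion K)).IsIntegral (w.adicCompletionIntegers K) := ⟨⟨_, rfl⟩⟩
    apply isMinimal_of_exp_neg_twelve_lt_valued_Δ_place
    have hΔ : ((J.map (algebraMap (v.adicCompletionIntegers ℚ) (w.adicCompletionIntegers K))).baseChange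
        (w.adicCompletion K)).Δ = ι ((J.Δ : v.adicCompletionIntegers ℚ) : v.adicCompletion ℚ) := by
      rw [baseChange, map_Δ, map_Δ, halg, ← hψ]; rfl
    rw [hΔ, hιv]
    exact exp_neg_twelve_lt_valued_Δ_of_normalForm_IVstar v J h1 h2 irreducible_uniformizer hγ h4 hε
      hdisc h3
  have hcurve : (W.baseChange K).baseChange (w.adicCompletion K) =
      (W.baseChange (v.adicCompletion ℚ)).baseChange (w.adicCompletion K) := by
    simp only [baseChange, WeierstrassCurve.map_map]
    rw [Subsingleton.elim ((algebraMap K (w.adicCompletion K)).comp (algebraMap ℚ K))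
      ((algebraMap (v.adicCompletion ℚ) (w.adicCompletion K)).comp (algebraMap ℚ (v.adicCompletion ℚ)))]
  rw [hcurve, localTamagawaNumber_baseChange_eq_three_iff_of_normalForm_IVstar
    (W.baseChange (v.adicCompletion ℚ)) J D hJ h1 h2 hϖ hγ h4 hε hdisc,
    localTamagawaNumber_eq_three_iff_exists_root_of_normalForm_IVstar (W.baseChange (v.adicCompletion ℚ))
    J D hJ h1 h2 irreducible_uniformizer hγ h4 hε hdisc]
  have hodd : Odd (Module.finrank (ResidueField (v.adicCompletionIntegers ℚ))
      (ResidueField (w.adicCompletionIntegers K))) := by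
    rw [finrank_residueField_eq_inertiaDeg v hw]; exact hf
  have key := splits_map_iff_of_natDegree_eq_two_of_odd_finrank
    (E := ResidueField (w.adicCompletionIntegers K))
    (natDegree_stepQuadratic (residue _ γ) (residue _ ε)) hodd
  have up := exists_root_map_iff_splits (algebraMap (ResidueField (v.adicCompletionIntegers ℚ))
    (ResidueField (w.adicCompletionIntegers K))) (residue _ γ) (residue _ ε)
  have down := exists_root_map_iff_splits (RingHom.id (ResidueField (v.adicCompletionIntegers ℚ)))
    (residue _ γ) (residue _ ε)
  simp only [ResidueField.algebraMap_residue] at up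
  simp only [RingHom.id_apply, Polynomial.map_id] at down
  rw [up, down, key]

end TypeIVTwist

end Summit.BirchSwinnertonDyer.Rank1Residual.AdditivePotMult

end
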